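import Mathlib
import Literature.RepresentationTheory.FiniteGroups.InducedClassFunction
import Summits.MatrixMultiplication.MatrixMultiplication.Theorems.SubgroupIdentityDesigns.Negative.ParabolicSubgroup
import Summits.MatrixMultiplication.MatrixMultiplication.Theorems.SubgroupIdentityDesigns.Negative.ParabolicMackeySum
import Summits.MatrixMultiplication.MatrixMultiplication.Theorems.SubgroupIdentityDesigns.Negative.ParabolicBruhat
import Summits.MatrixMultiplication.MatrixMultiplication.Theorems.SubgroupIdentityDesigns.Negative.ParabolicLink

/-!
# The intersection group `H_i = P_c ∩ w(π_i) P_j w(π_i)⁻¹` maps onto the linked pair group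

Support file toward the maximal-parabolic Mackey formula `SteinbergTower.MackeyFormula`
(crux `SubgroupIdentityDesigns`, negative side; VALUE = reusable finite-group bookkeeping,
NOT summit progress).

For an admissible block size `i` (`i ≤ c`, `i ≤ j`, `c + j ≤ N + i`) and the block-swap
representative `W = w(π_i)` (`ParabolicBruhat.swapPerm`), the homomorphism
`Ψ_W : H_W → GL_c × GL_j`, `y ↦ (ul_c y, ul_j (W⁻¹ y W))` (`ParabolicMackeySum.meetHom`) takes
values in the linked pair group `C_i` (`ParabolicLink.linkSub`) and is ONTO it (`psi`,
`psi_surjective`): a preimage of `(A, B)` is `lift_c(A) · W lift_j(B') W⁻¹` with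
`B' = lift(x)⁻¹ B`, `x` the common `i × i` corner.  [folklore]
-/

set_option linter.dupNamespace false
set_option maxHeartbeats 800000

noncomputable section

open scoped BigOperators Classical
open Literature.RepresentationTheory.FiniteGroups

namespace Summit.MatrixMultiplication.MatrixMultiplication.Theorems.SubgroupIdentityDesigns.Negative

namespace ParabolicMeet

open ParabolicSubgroup ParabolicMackeySum ParabolicBruhat ParabolicLink

variable {F : Type} [Field F] [Fintype F] [DecidableEq F] {N c j i : ℕ}

/-! ## Values of the block swap `π_i` and its inverse -/

/-- `π_i x = x` for `x < i`. -/
theorem val_lt (hic : i ≤ c) (hij : i ≤ j) (hc : c ≤ N) (h : c + j ≤ N + i) (x : Fin N)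
    (hx : (x : ℕ) < i) : ((swapPerm N c j i x : Fin N) : ℕ) = x := by
  rw [swapPerm_val hic hij hc h]
  unfold swapFun
  rw [if_pos hx]

/-- `π_i x = x + (c - i)` for `i ≤ x < j`. -/
theorem val_mid (hic : i ≤ c) (hij : i ≤ j) (hc : c ≤ N) (h : c + j ≤ N + i) (x : Fin N)
    (h1 : i ≤ (x : ℕ)) (h2 : (x : ℕ) < j) :
    ((swapPerm N c j i x : Fin N) : ℕ) = x + (c - i) := by
  rw [swapPerm_val hic hij hc h]
  unfold swapFun
  rw [if_neg (by omega), if_pos h2]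

/-- `π_i⁻¹ y = y` for `y < i`. -/
theorem symm_val_lt (hic : i ≤ c) (hij : i ≤ j) (hc : c ≤ N) (h : c + j ≤ N + i) (y : Fin N)
    (hy : (y : ℕ) < i) : (((swapPerm N c j i)⁻¹ y : Fin N) : ℕ) = y := by
  rw [swapPerm_symm_val hic hij hc h]
  unfold swapInv
  rw [if_pos hy]

/-- `π_i⁻¹ y = y + (j - i)` for `i ≤ y < c`. -/
theorem symm_val_mid1 (hic : i ≤ c) (hij : i ≤ j) (hc : c ≤ N) (h : c + j ≤ N + i) (y : Fin N)
    (h1 : i ≤ (y : ℕ)) (h2 : (y : ℕ) < c) :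
    (((swapPerm N c j i)⁻¹ y : Fin N) : ℕ) = y + (j - i) := by
  rw [swapPerm_symm_val hic hij hc h]
  unfold swapInv
  rw [if_neg (by omega), if_pos h2]

/-- `π_i⁻¹ y = y - (c - i)` for `c ≤ y < c + j - i`. -/
theorem symm_val_mid2 (hic : i ≤ c) (hij : i ≤ j) (hc : c ≤ N) (h : c + j ≤ N + i) (y : Fin N)
    (h1 : c ≤ (y : ℕ)) (h2 : (y : ℕ) < c + j - i) :
    (((swapPerm N c j i)⁻¹ y : Fin N) : ℕ) = y - (c - i) := by
  rw [swapPerm_symm_val hic hij hc h]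
  unfold swapInv
  rw [if_neg (by omega), if_neg (by omega), if_pos h2]

/-- `π_i⁻¹ y = y` for `c + j - i ≤ y`. -/
theorem symm_val_ge (hic : i ≤ c) (hij : i ≤ j) (hc : c ≤ N) (h : c + j ≤ N + i) (y : Fin N)
    (h1 : c + j - i ≤ (y : ℕ)) : (((swapPerm N c j i)⁻¹ y : Fin N) : ℕ) = y := by
  rw [swapPerm_symm_val hic hij hc h]
  unfold swapInv
  rw [if_neg (by omega), if_neg (by omega), if_neg (by omega)]

omit [Fintype F] [DecidableEq F] in
/-- Entries of `w(σ) g w(σ)⁻¹`. -/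
theorem permGL_conj_apply (σ : Equiv.Perm (Fin N)) (g : GL (Fin N) F) (a b : Fin N) :
    ((permGL σ * g * (permGL σ)⁻¹ : GL (Fin N) F) : Matrix (Fin N) (Fin N) F) a b =
      (g : Matrix (Fin N) (Fin N) F) (σ⁻¹ a) (σ⁻¹ b) := by
  have e : (permGL σ * g * (permGL σ)⁻¹ : GL (Fin N) F) =
      (permGL σ⁻¹ : GL (Fin N) F)⁻¹ * g * permGL σ⁻¹ := by
    rw [permGL_inv, permGL_inv, inv_inv]
  rw [e, conj_permGL_apply]

/-! ## `Ψ_W` takes values in `C_i` -/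

/-- For `y ∈ H_W` (`W = w(π_i)`), `Ψ_W(y) ∈ C_i`. -/
theorem meetHom_mem_linkSub (hic : i ≤ c) (hij : i ≤ j) (hc : c ≤ N) (hj : j ≤ N)
    (h : c + j ≤ N + i) (y : meet c j (permGL (swapPerm N c j i) : GL (Fin N) F)) :
    meetHom hc hj (permGL (swapPerm N c j i)) y ∈ linkSub F hic hij := by
  refine ⟨?_, ?_, ?_⟩
  · -- `ul_c y ∈ P^c_i`
    rw [meetHom_fst, mem_parab]
    intro s t ht hs
    rw [ul_apply]
    have key := mem_parab.mp y.2.2 ((swapPerm N c j i)⁻¹ (Fin.castLE hc s))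
      ((swapPerm N c j i)⁻¹ (Fin.castLE hc t))
      (by rw [symm_val_lt hic hij hc h _ (by simp only [Fin.val_castLE]; exact ht)]
          simp only [Fin.val_castLE]; omega)
      (by rw [symm_val_mid1 hic hij hc h _ (by simp only [Fin.val_castLE]; exact hs)
            (by simp only [Fin.val_castLE]; exact s.2)]
          simp only [Fin.val_castLE]; omega)
    rw [conj_permGL_apply] at key
    simp only [Equiv.Perm.coe_inv, Equiv.apply_symm_apply] at key
    exact key
  · -- `ul_j (W⁻¹ y W) ∈ P^j_i`
    rw [meetHom_snd, mem_parab]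
    intro a b hb ha
    rw [ul_apply, conj_permGL_apply]
    exact mem_parab.mp y.2.1 _ _
      (by rw [val_lt hic hij hc h _ (by simp only [Fin.val_castLE]; exact hb)]
          simp only [Fin.val_castLE]; omega)
      (by rw [val_mid hic hij hc h _ (by simp only [Fin.val_castLE]; exact ha)
            (by simp only [Fin.val_castLE]; exact a.2)]
          simp only [Fin.val_castLE]; omega)
  · -- the corners agree
    rw [meetHom_fst, meetHom_snd]
    refine Matrix.ext fun s t => ?_
    show ((ul hc ⟨_, y.2.1⟩ : GL (Fin c) F) : Matrix (Fin c) (Fin c) F) (Fin.castLE hic s)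
        (Fin.castLE hic t) =
      ((ul hj ⟨_, y.2.2⟩ : GL (Fin j) F) : Matrix (Fin j) (Fin j) F) (Fin.castLE hij s)
        (Fin.castLE hij t)
    rw [ul_apply, ul_apply, conj_permGL_apply]
    have e : ∀ r : Fin i, swapPerm N c j i (Fin.castLE hj (Fin.castLE hij r)) =
        Fin.castLE hc (Fin.castLE hic r) := fun r =>
      Fin.ext (by
        rw [val_lt hic hij hc h _ (by simp only [Fin.val_castLE]; exact r.2)]
        simp only [Fin.val_castLE])
    rw [e s, e t]

/-- **`Ψ_i : H_i → C_i`** (the codomain restriction of `meetHom`). -/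
def psi (hic : i ≤ c) (hij : i ≤ j) (hc : c ≤ N) (hj : j ≤ N) (h : c + j ≤ N + i) :
    meet c j (permGL (swapPerm N c j i) : GL (Fin N) F) →* linkSub F hic hij :=
  (meetHom hc hj (permGL (swapPerm N c j i))).codRestrict (linkSub F hic hij)
    (meetHom_mem_linkSub hic hij hc hj h)

/-- Underlying pair of `Ψ_i y`. -/
theorem psi_apply (hic : i ≤ c) (hij : i ≤ j) (hc : c ≤ N) (hj : j ≤ N) (h : c + j ≤ N + i)
    (y : meet c j (permGL (swapPerm N c j i) : GL (Fin N) F)) :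
    ((psi hic hij hc hj h y : linkSub F hic hij) : GL (Fin c) F × GL (Fin j) F) =
      meetHom hc hj (permGL (swapPerm N c j i)) y := rfl

/-! ## Surjectivity: the explicit preimage -/

/-- `W lift_j(B') W⁻¹ ∈ Q_c` for `B' ∈ P^j_i ∩ Q^j_i` (`W = w(π_i)`). -/
theorem conj_lift_mem_fixer (hic : i ≤ c) (hij : i ≤ j) (hc : c ≤ N) (hj : j ≤ N)
    (h : c + j ≤ N + i) {B' : GL (Fin j) F} (hB'Q : B' ∈ fixer F j i) :
    (permGL (swapPerm N c j i) * lift hj B' * (permGL (swapPerm N c j i))⁻¹ : GL (Fin N) F) ∈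
      fixer F N c := by
  rw [mem_fixer]
  intro s t htc
  rw [permGL_conj_apply, lift_apply]
  -- the `else` branch is always right
  have hgen : (if (swapPerm N c j i)⁻¹ s = (swapPerm N c j i)⁻¹ t then (1 : F) else 0) =
      if s = t then 1 else 0 := if_congr (Equiv.apply_eq_iff_eq _) rfl rfl
  rcases Nat.lt_or_ge (t : ℕ) i with hti | hti
  · have hv := symm_val_lt hic hij hc h t hti
    have hvj : (((swapPerm N c j i)⁻¹ t : Fin N) : ℕ) < j := by rw [hv]; omega
    have hvi : (((swapPerm N c j i)⁻¹ t : Fin N) : ℕ) < i := by rw [hv]; exact hti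
    rcases Nat.lt_or_ge (s : ℕ) i with hsi | hsi
    · have hu := symm_val_lt hic hij hc h s hsi
      have huj : (((swapPerm N c j i)⁻¹ s : Fin N) : ℕ) < j := by rw [hu]; omega
      rw [dif_pos huj, dif_pos hvj, mem_fixer.mp hB'Q _ _ hvi]
      refine if_congr ?_ rfl rfl
      rw [Fin.mk.inj_iff, hu, hv]
      exact Fin.ext_iff.symm
    · rcases Nat.lt_or_ge (s : ℕ) c with hsc | hsc
      · have hu := symm_val_mid1 hic hij hc h s hsi hsc
        rw [dif_neg (by rw [hu]; omega), hgen]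
      · rcases Nat.lt_or_ge (s : ℕ) (c + j - i) with hs2 | hs2
        · have hu := symm_val_mid2 hic hij hc h s hsc hs2
          have huj : (((swapPerm N c j i)⁻¹ s : Fin N) : ℕ) < j := by rw [hu]; omega
          rw [dif_pos huj, dif_pos hvj, mem_fixer.mp hB'Q _ _ hvi]
          refine if_congr (iff_of_false ?_ ?_) rfl rfl
          · rw [Fin.mk.inj_iff, hu, hv]
            omega
          · rw [Fin.ext_iff]
            omega
        · have hu := symm_val_ge hic hij hc h s hs2
          rw [dif_neg (by rw [hu]; omega), hgen]
  · have hv := symm_val_mid1 hic hij hc h t hti htc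
    by_cases hsj : (((swapPerm N c j i)⁻¹ s : Fin N) : ℕ) < j
    · rw [dif_pos hsj, dif_neg (by rw [hv]; omega), if_neg]
      rintro rfl
      rw [hv] at hsj
      omega
    · rw [dif_neg hsj, hgen]

/-- `W⁻¹ lift_c(A) W ∈ P_j` for `A ∈ P^c_i` (`W = w(π_i)`). -/
theorem conj_lift_mem_parab (hic : i ≤ c) (hij : i ≤ j) (hc : c ≤ N)
    (h : c + j ≤ N + i) {A : GL (Fin c) F} (hA : A ∈ parab F c i) :
    ((permGL (swapPerm N c j i))⁻¹ * lift hc A * permGL (swapPerm N c j i) : GL (Fin N) F) ∈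
      parab F N j := by
  rw [mem_parab]
  intro a b hb ha
  rw [conj_permGL_apply, lift_apply]
  rcases Nat.lt_or_ge (a : ℕ) (c + j - i) with ha2 | ha2
  · have hu : ((swapPerm N c j i a : Fin N) : ℕ) = a - (j - i) := by
      rw [swapPerm_val hic hij hc h]
      unfold swapFun
      rw [if_neg (by omega), if_neg (by omega), if_pos ha2]
    have huc : ((swapPerm N c j i a : Fin N) : ℕ) < c := by rw [hu]; omega
    rw [dif_pos huc]
    rcases Nat.lt_or_ge (b : ℕ) i with hbi | hbi
    · have hv := val_lt hic hij hc h b hbi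
      rw [dif_pos (by rw [hv]; omega)]
      exact mem_parab.mp hA _ _ (by rw [hv]; exact hbi) (by rw [hu]; omega)
    · have hv := val_mid hic hij hc h b hbi hb
      rw [dif_neg (by rw [hv]; omega)]
  · have hu : ((swapPerm N c j i a : Fin N) : ℕ) = a := by
      rw [swapPerm_val hic hij hc h]
      unfold swapFun
      rw [if_neg (by omega), if_neg (by omega), if_neg (by omega)]
    rw [dif_neg (by rw [hu]; omega), if_neg]
    intro e
    have := (Equiv.apply_eq_iff_eq _).mp e
    rw [Fin.ext_iff] at this
    omega

/-- `ul_j (W⁻¹ lift_c(A) W) = lift^j_i (ul_i A)` for `A ∈ P^c_i`. -/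
theorem ul_conj_lift (hic : i ≤ c) (hij : i ≤ j) (hc : c ≤ N) (hj : j ≤ N)
    (h : c + j ≤ N + i) {A : GL (Fin c) F} (hA : A ∈ parab F c i) :
    ul hj ⟨_, conj_lift_mem_parab hic hij hc h hA⟩ = lift hij (ul hic ⟨A, hA⟩) := by
  refine Units.ext (Matrix.ext fun a b => ?_)
  rw [ul_apply, lift_apply]
  show (((permGL (swapPerm N c j i))⁻¹ * lift hc A * permGL (swapPerm N c j i) : GL (Fin N) F) :
      Matrix (Fin N) (Fin N) F) (Fin.castLE hj a) (Fin.castLE hj b) = _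
  rw [conj_permGL_apply, lift_apply]
  rcases Nat.lt_or_ge (a : ℕ) i with hai | hai
  · have hu := val_lt hic hij hc h (Fin.castLE hj a) (by simp only [Fin.val_castLE]; exact hai)
    simp only [Fin.val_castLE] at hu
    rw [dif_pos (show ((swapPerm N c j i (Fin.castLE hj a) : Fin N) : ℕ) < c by rw [hu]; omega),
      dif_pos hai]
    rcases Nat.lt_or_ge (b : ℕ) i with hbi | hbi
    · have hv := val_lt hic hij hc h (Fin.castLE hj b) (by simp only [Fin.val_castLE]; exact hbi)
      simp only [Fin.val_castLE] at hv
      rw [dif_pos (show ((swapPerm N c j i (Fin.castLE hj b) : Fin N) : ℕ) < c by rw [hv]; omega),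
        dif_pos hbi, ul_apply]
      have e1 : (⟨((swapPerm N c j i (Fin.castLE hj a) : Fin N) : ℕ), by rw [hu]; omega⟩ : Fin c) =
          Fin.castLE hic ⟨a, hai⟩ := Fin.ext (by simp only [Fin.val_castLE]; exact hu)
      have e2 : (⟨((swapPerm N c j i (Fin.castLE hj b) : Fin N) : ℕ), by rw [hv]; omega⟩ : Fin c) =
          Fin.castLE hic ⟨b, hbi⟩ := Fin.ext (by simp only [Fin.val_castLE]; exact hv)
      rw [e1, e2]
    · have hv := val_mid hic hij hc h (Fin.castLE hj b) (by simp only [Fin.val_castLE]; exact hbi)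
        (by simp only [Fin.val_castLE]; exact b.2)
      simp only [Fin.val_castLE] at hv
      rw [dif_neg (show ¬ ((swapPerm N c j i (Fin.castLE hj b) : Fin N) : ℕ) < c by rw [hv]; omega),
        dif_neg (by omega)]
  · have hu := val_mid hic hij hc h (Fin.castLE hj a) (by simp only [Fin.val_castLE]; exact hai)
      (by simp only [Fin.val_castLE]; exact a.2)
    simp only [Fin.val_castLE] at hu
    rw [dif_neg (show ¬ ((swapPerm N c j i (Fin.castLE hj a) : Fin N) : ℕ) < c by rw [hu]; omega),
      dif_neg (by omega)]
    refine if_congr ?_ rfl rfl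
    rw [Equiv.apply_eq_iff_eq, (Fin.castLE_injective hj).eq_iff]

/-- **`Ψ_i` is onto `C_i`.** -/
theorem psi_surjective (hic : i ≤ c) (hij : i ≤ j) (hc : c ≤ N) (hj : j ≤ N)
    (h : c + j ≤ N + i) : Function.Surjective (psi (F := F) hic hij hc hj h) := by
  rintro ⟨⟨A, B⟩, hA, hB, hAB⟩
  simp only at hA hB hAB
  set W : GL (Fin N) F := permGL (swapPerm N c j i) with hW
  set x : GL (Fin i) F := ul hic ⟨A, hA⟩ with hx
  have hxB : ul hij ⟨B, hB⟩ = x := ((ulMat_eq_iff hic hij ⟨A, hA⟩ ⟨B, hB⟩).mp hAB).symm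
  set B' : GL (Fin j) F := (lift hij x)⁻¹ * B with hB'
  have hB'P : B' ∈ parab F j i := (parab F j i).mul_mem ((parab F j i).inv_mem (lift_mem_parab hij x)) hB
  have hB'Q : B' ∈ fixer F j i := by
    rw [← ul_eq_one_iff hij ⟨B', hB'P⟩]
    have e : (⟨B', hB'P⟩ : parab F j i) = ⟨lift hij x, lift_mem_parab hij x⟩⁻¹ * ⟨B, hB⟩ :=
      Subtype.ext rfl
    rw [e, map_mul, map_inv, ul_lift, hxB, inv_mul_cancel]
  set Z : GL (Fin N) F := W * lift hj B' * W⁻¹ with hZ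
  have hZQ : Z ∈ fixer F N c := conj_lift_mem_fixer hic hij hc hj h hB'Q
  set y : GL (Fin N) F := lift hc A * Z with hy
  have hy1 : y ∈ parab F N c := (parab F N c).mul_mem (lift_mem_parab hc A) (fixer_le_parab hZQ)
  have hV := conj_lift_mem_parab hic hij hc h hA
  have hy2e : W⁻¹ * y * W = (W⁻¹ * lift hc A * W) * lift hj B' := by
    rw [hy, hZ]; group
  have hy2 : W⁻¹ * y * W ∈ parab F N j := by
    rw [hy2e]
    exact (parab F N j).mul_mem hV (lift_mem_parab hj B')
  refine ⟨⟨y, hy1, hy2⟩, Subtype.ext (Prod.ext ?_ ?_)⟩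
  · show (meetHom hc hj W ⟨y, hy1, hy2⟩).1 = A
    rw [meetHom_fst]
    have e : (⟨y, hy1⟩ : parab F N c) =
        ⟨lift hc A, lift_mem_parab hc A⟩ * ⟨Z, fixer_le_parab hZQ⟩ := Subtype.ext rfl
    rw [e, map_mul, ul_lift, (ul_eq_one_iff hc _).mpr hZQ, mul_one]
  · show (meetHom hc hj W ⟨y, hy1, hy2⟩).2 = B
    rw [meetHom_snd]
    have e : (⟨W⁻¹ * y * W, hy2⟩ : parab F N j) =
        ⟨W⁻¹ * lift hc A * W, hV⟩ * ⟨lift hj B', lift_mem_parab hj B'⟩ := Subtype.ext hy2e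
    rw [e, map_mul, ul_conj_lift hic hij hc hj h hA, ul_lift, hB', mul_inv_cancel_left]

end ParabolicMeet

end Summit.MatrixMultiplication.MatrixMultiplication.Theorems.SubgroupIdentityDesigns.Negative

end
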